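import Summits.BirchSwinnertonDyer.BirchSwinnertonDyer.Theorems.AlignedTransportAtTwoMainConjectureOfRankZeroBSDAtTwoFineRoadKleinExtensionS3
import Mathlib.Algebra.Module.ZMod
import Mathlib.LinearAlgebra.FreeModule.Finite.Matrix
import Mathlib.FieldTheory.Finiteness
import HarnessLib

/-!
# Route `AlignedTransportAtTwo`, crux C2 `MainConjectureOfRankZeroBSDAtTwo` (stmt-BirchSwinnertonDyer-22298),
# road (b″): PERFECT DESCENT at `2`, part VI — the COUNTING LEMMA (PERFECT-DESCENT.md §3 (iii)), `C₃`-part: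
# `#Hom_σ(V, V₄) = #((σ + σ²)V)` for a `2`-torsion module `V` under a `3`-cycle `σ`

Cell `bsd-f1-sign2`, WIDTH-5 attach seat `bsd-line-att-p3` (gen 4) on line `birth` of crux C2
(`--supports` stmt-BirchSwinnertonDyer-22298; closes nothing). HONEST FRAMING: THEOREMS ONLY — no definition, no
named fact, no instance, no `sorry`; BSD is NOT proved by any of this. The lead's FREE helper target (c1) (bus
2026-08-28T04:46:58Z): the counting lemma of §3 (iii) of `Cruxes/MainConjectureOfRankZeroBSDAtTwo/PERFECT-DESCENT.md`
in FINITE form, as pure algebra over the toolkit of parts I–IV. Setting: a group `Q` acting on the Klein four-group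
`M` (`#M = 4`, `m + m = 0`) with a fixed-point-free `σ ∈ Q` (a `3`-cycle: `1 + σ + σ² = 0` on `M`, so `M ≅ 𝔽₄` with
`σ ↦ ω`), and on an additive group `V` with `v + v = 0` on which the kernel of the action on `M` acts trivially (so
`σ³ = 1` on `V`). Write `e₁ v = v + σ v + σ² v` and `(1 − e₁) v = σ v + σ² v` (complementary idempotents,
`e₁` central).

## What is proved

* §1 **`natCard_addMonoidHom_of_two_torsion`**: for a finite group `U` with `u + u = 0` and a group `A` of order `2`,
  `#(U →+ A) = #U` (dual of an `𝔽₂`-vector space; Mathlib `Module.finrank_linearMap`, `Subspace` finrank).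
* §2 the idempotent calculus on `V` (`e₁ σ = σ e₁ = e₁`, `e₁² = e₁`, `e₁ (1 − e₁) = 0`) and **`map_e1_eq_zero`**:
  a `σ`-equivariant additive `f : V →+ M` kills `e₁ V` (`1 + σ + σ² = 0` on `M`), so `f v = f ((1 − e₁) v)`.
* §3 **`natCard_sigmaEquivariant_eq`** (finite `V`): `#{f : V →+ M | f ∘ σ = σ ∘ f} = #{w ∈ V | e₁ w = 0}`
  `= #((1 − e₁)V)`: the `σ`-equivariant maps are the `𝔽₄`-LINEAR maps `(1−e₁)V → M ≅ 𝔽₄`, and an `𝔽₄`-linear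
  functional is the same as its `ω`-coordinate, an ARBITRARY additive functional `(1−e₁)V → 𝔽₂` (explicit bijection
  `φ ↦ (v ↦ σ • φ((1−e₁)v) + σ² • φ((1−e₁)σ v))`, inverse `f ↦ p ∘ f` for a coordinate projection `p : M → {0, m₀}`
  built with the tree's `klein_exists_addEquiv`); then §1.
* §4 **`natCard_equivariant_eq_of_no_transposition`** (`Q̄ = C₃`: every element acts on `M` trivially or without
  fixed point): `Q`-equivariant = `σ`-equivariant, so `#Hom_Q(V, M) = #((1 − e₁)V)` — the lead's «for `G_∞ = C₃`
  read `𝔽₄` for `N`: `[V : 𝔽₄] = ½ dim (1 − e₁)V`», in the form `dim_{𝔽₂} Hom = dim_{𝔽₂} (1 − e₁)V`.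

The `S₃`-refinement (`#Hom_{S₃}(V, M)² = #((1 − e₁)V)`: Galois descent along the transposition) and the `Λ`-adic
form («`Hom(M/2M, V₄)` finite ⟺ `μ((1 − e₁)M) = 0`») are NOT here; the latter is typing (structure of
`Λ`-modules), the former a sequel.

References: J.-P. Serre, *Linear Representations of Finite Groups*, §2.6 (canonical decomposition / isotypic
projectors); K. S. Brown, *Cohomology of Groups*, VI.8; PERFECT-DESCENT.md §3 (iii) (lead att-p2 g4).
-/

set_option autoImplicit false
-- the Theorems namespace of this sub repeats the summit name by design (D-0017 nested layout)
set_option linter.dupNamespace false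

namespace Summit.BirchSwinnertonDyer.BirchSwinnertonDyer.Theorems.AlignedTransportAtTwoFineRoad.PerfectDescent

open Summit.BirchSwinnertonDyer.BirchSwinnertonDyer.Theorems.MultTransportAtTwo

/-! ## §1 The dual of a finite elementary abelian `2`-group has the same order -/

section Dual

/-- **`#Hom(U, ℤ/2) = #U`** for a finite group `U` of exponent `2`: with `A` any group of order `2`,
`#(U →+ A) = #U` (additive maps are `𝔽₂`-linear, `A ≅ 𝔽₂`, and a finite-dimensional vector space and its dual
have the same dimension). [cite: SerreGaloisCohomology1997, I §5.1] -/
theorem natCard_addMonoidHom_of_two_torsion {U A : Type*} [AddCommGroup U] [AddCommGroup A] [Finite U]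
    (hU : ∀ u : U, u + u = 0) (hA2 : ∀ a : A, a + a = 0) (hA : Nat.card A = 2) :
    Nat.card (U →+ A) = Nat.card U := by
  letI mU : Module (ZMod 2) U := AddCommGroup.zmodModule (fun u ↦ by rw [two_nsmul, hU])
  letI mA : Module (ZMod 2) A := AddCommGroup.zmodModule (fun a ↦ by rw [two_nsmul, hA2])
  haveI : Finite A := Nat.finite_of_card_ne_zero (by rw [hA]; norm_num)
  have hZ : Nat.card (ZMod 2) = 2 := by simp
  have hfA : Module.finrank (ZMod 2) A = 1 := by
    have h := Module.natCard_eq_pow_finrank (K := ZMod 2) (V := A)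
    rw [hA, hZ] at h
    have h1 : (2 : ℕ) ^ 1 = 2 ^ Module.finrank (ZMod 2) A := by rw [pow_one]; exact h
    exact (Nat.pow_right_injective le_rfl h1).symm
  rw [Nat.card_congr (AddMonoidHom.toZModLinearMapEquiv 2 (M := U) (M₁ := A)).toEquiv,
    Module.natCard_eq_pow_finrank (K := ZMod 2) (V := U →ₗ[ZMod 2] A),
    Module.finrank_linearMap (ZMod 2) (ZMod 2) U A, hfA, mul_one, hZ,
    Module.natCard_eq_pow_finrank (K := ZMod 2) (V := U), hZ]

end Dual

/-! ## §2 The idempotents `e₁ = 1 + σ + σ²`, `1 − e₁ = σ + σ²` on a `2`-torsion module with `σ³ = 1` -/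

section Idempotents

variable {Q : Type*} [Group Q] {M : Type*} [AddCommGroup M] [DistribMulAction Q M]
  {V : Type*} [AddCommGroup V] [DistribMulAction Q V]

/-- `σ³ = 1` on `V` when `σ` is fixed-point-free on the Klein four-group `M` (a `3`-cycle, `σ³` acts trivially
on `M`) and the kernel of the action on `M` acts trivially on `V`. [folklore] -/
theorem smul_smul_smul_eq_self_of_kernel (h4 : Nat.card M = 4) (h2 : ∀ m : M, m + m = 0) {σ : Q}
    (hσ : ∀ m : M, σ • m = m → m = 0) (hVN : ∀ g : Q, (∀ m : M, g • m = m) → ∀ v : V, g • v = v) (v : V) :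
    σ • (σ • (σ • v)) = v := by
  have h := hVN (σ * σ * σ) (fun m ↦ by rw [mul_smul, mul_smul, smul_smul_smul_eq_self_of_fpf h4 h2 hσ]) v
  rwa [mul_smul, mul_smul] at h

/-- `e₁ (σ v) = e₁ v`. [folklore] -/
theorem e1_smul_eq {σ : Q} (hσ3 : ∀ v : V, σ • (σ • (σ • v)) = v) (v : V) :
    σ • v + σ • (σ • v) + σ • (σ • (σ • v)) = v + σ • v + σ • (σ • v) := by
  rw [hσ3]; abel

/-- `σ (e₁ v) = e₁ v`. [folklore] -/
theorem smul_e1_eq {σ : Q} (hσ3 : ∀ v : V, σ • (σ • (σ • v)) = v) (v : V) :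
    σ • (v + σ • v + σ • (σ • v)) = v + σ • v + σ • (σ • v) := by
  rw [smul_add, smul_add, hσ3]; abel

/-- `e₁² = e₁` (with `2 = 0` on `V`). [folklore] -/
theorem e1_e1_eq {σ : Q} (hσ3 : ∀ v : V, σ • (σ • (σ • v)) = v) (hV2 : ∀ v : V, v + v = 0) (v : V) :
    (v + σ • v + σ • (σ • v)) + σ • (v + σ • v + σ • (σ • v)) + σ • (σ • (v + σ • v + σ • (σ • v))) =
      v + σ • v + σ • (σ • v) := by
  rw [smul_e1_eq hσ3, smul_e1_eq hσ3, hV2, zero_add]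

/-- `e₁ (1 − e₁) = 0`: `e₁ (σ v + σ² v) = 0`. [folklore] -/
theorem e1_f_eq_zero {σ : Q} (hσ3 : ∀ v : V, σ • (σ • (σ • v)) = v) (hV2 : ∀ v : V, v + v = 0) (v : V) :
    (σ • v + σ • (σ • v)) + σ • (σ • v + σ • (σ • v)) + σ • (σ • (σ • v + σ • (σ • v))) = 0 := by
  simp only [smul_add, hσ3]
  have e : σ • v + σ • (σ • v) + (σ • (σ • v) + v) + (v + σ • v) = (v + v) + (σ • v + σ • v) +
      (σ • (σ • v) + σ • (σ • v)) := by abel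
  rw [e]
  simp only [hV2]

/-- `(1 − e₁)² = 1 − e₁` on `ker e₁`: for `w` with `e₁ w = 0`, `σ w + σ² w = w`. [folklore] -/
theorem f_eq_self_of_e1_eq_zero {σ : Q} (hV2 : ∀ v : V, v + v = 0) {w : V} (hw : w + σ • w + σ • (σ • w) = 0) :
    σ • w + σ • (σ • w) = w := by
  have e : w + (σ • w + σ • (σ • w)) = 0 := by rw [← add_assoc]; exact hw
  rw [← neg_eq_of_add_eq_zero_right e, klein_neg_eq hV2]

/-- **A `σ`-equivariant additive map into the Klein four-group kills `e₁ V`**: `f (v + σ v + σ² v) = (1 + σ + σ²) f v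
= 0` (`σ` fixed-point-free on `M`). Hence `Hom_σ(V, M) = Hom_σ((1 − e₁)V, M)`. [folklore] -/
theorem map_e1_eq_zero (h4 : Nat.card M = 4) (h2 : ∀ m : M, m + m = 0) {σ : Q}
    (hσ : ∀ m : M, σ • m = m → m = 0) (f : V →+ M) (hf : ∀ v : V, f (σ • v) = σ • f v) (v : V) :
    f (v + σ • v + σ • (σ • v)) = 0 := by
  rw [map_add, map_add, hf, hf, hf]
  exact add_smul_add_smul_smul_eq_zero_of_fpf h4 h2 hσ (f v)

/-- `f v = f (σ v + σ² v)` for `σ`-equivariant `f` (as `f` kills `e₁ v = v + σ v + σ² v`). [folklore] -/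
theorem map_eq_map_f (h4 : Nat.card M = 4) (h2 : ∀ m : M, m + m = 0) {σ : Q}
    (hσ : ∀ m : M, σ • m = m → m = 0) (f : V →+ M) (hf : ∀ v : V, f (σ • v) = σ • f v) (v : V) :
    f v = f (σ • v + σ • (σ • v)) := by
  have h := map_e1_eq_zero h4 h2 hσ f hf v
  rw [add_assoc, map_add] at h
  rw [← klein_neg_eq h2 (f v)]
  exact neg_eq_of_add_eq_zero_right h

end Idempotents

/-! ## §3 The `C₃`-count: `#Hom_σ(V, M) = #((σ + σ²)V)` -/

section Count

variable {Q : Type*} [Group Q] {M : Type*} [AddCommGroup M] [DistribMulAction Q M]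
  {V : Type*} [AddCommGroup V] [DistribMulAction Q V]

/-- **Counting lemma, `C₃`-part.** Let `σ ∈ Q` act without non-zero fixed point on the Klein four-group `M`, and
let `V` be a FINITE additive group with `v + v = 0` and a `Q`-action under which the kernel of the action on `M` acts
trivially. Then the number of `σ`-equivariant additive maps `V → M` equals the number of `w ∈ V` with
`w + σ w + σ² w = 0`, i.e. `#Hom_σ(V, M) = #((σ + σ²)V) = #((1 − e₁)V)`: the `σ`-equivariant maps are the
`𝔽₄ = 𝔽₂[σ]`-linear maps `(1 − e₁)V → M ≅ 𝔽₄`, in bijection (taking the `ω`-coordinate) with all additive maps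
`(1 − e₁)V → 𝔽₂`, counted by `natCard_addMonoidHom_of_two_torsion`.
[cite: SerreGaloisCohomology1997, I §5.1] -/
theorem natCard_sigmaEquivariant_eq [Finite V] (h4 : Nat.card M = 4) (h2 : ∀ m : M, m + m = 0) {σ : Q}
    (hσ : ∀ m : M, σ • m = m → m = 0) (hVN : ∀ g : Q, (∀ m : M, g • m = m) → ∀ v : V, g • v = v)
    (hV2 : ∀ v : V, v + v = 0) :
    Nat.card {f : V →+ M // ∀ v : V, f (σ • v) = σ • f v} =
      Nat.card {w : V // w + σ • w + σ • (σ • w) = 0} := by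
  classical
  have hσ3 : ∀ v : V, σ • (σ • (σ • v)) = v := smul_smul_smul_eq_self_of_kernel h4 h2 hσ hVN
  have hσ3M : ∀ m : M, σ • (σ • (σ • m)) = m := smul_smul_smul_eq_self_of_fpf h4 h2 hσ
  have hσσM : ∀ m : M, σ • (σ • m) = m + σ • m := smul_smul_eq_add_of_fpf h4 h2 hσ
  have hplusM : ∀ m : M, σ • m + σ • (σ • m) = m := fun m ↦ by
    rw [hσσM, add_left_comm, h2, add_zero]
  -- the subgroup `W = ker e₁ = (σ + σ²)V`
  let E : V →+ V := AddMonoidHom.mk' (fun v ↦ v + σ • v + σ • (σ • v)) (by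
    intro a b; simp only [smul_add]; abel)
  have hE : ∀ v : V, E v = v + σ • v + σ • (σ • v) := fun _ ↦ rfl
  let W : AddSubgroup V := E.ker
  have hW : ∀ w : V, w ∈ W ↔ w + σ • w + σ • (σ • w) = 0 := fun w ↦ by rw [AddMonoidHom.mem_ker, hE]
  have hFmem : ∀ v : V, σ • v + σ • (σ • v) ∈ W := fun v ↦ (hW _).mpr (e1_f_eq_zero hσ3 hV2 v)
  have hσmem : ∀ w : V, w ∈ W → σ • w ∈ W := fun w hw ↦ by
    rw [hW] at hw ⊢; rw [e1_smul_eq hσ3]; exact hw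
  -- `F : V →+ W`, `v ↦ σ v + σ² v`
  let F₀ : V →+ V := AddMonoidHom.mk' (fun v ↦ σ • v + σ • (σ • v)) (by
    intro a b; simp only [smul_add]; abel)
  have hF₀ : ∀ v : V, F₀ v = σ • v + σ • (σ • v) := fun _ ↦ rfl
  let F : V →+ W := AddMonoidHom.codRestrict F₀ W (fun v ↦ by rw [hF₀]; exact hFmem v)
  have hF : ∀ v : V, ((F v : W) : V) = σ • v + σ • (σ • v) := fun _ ↦ rfl
  have hFW : ∀ w : W, F w = w := fun w ↦ Subtype.ext (by
    rw [hF]; exact f_eq_self_of_e1_eq_zero hV2 ((hW w).mp w.2))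
  have hFσ : ∀ v : V, F (σ • v) = ⟨σ • (F v : V), hσmem _ (F v).2⟩ := fun v ↦ Subtype.ext (by
    change σ • (σ • v) + σ • (σ • (σ • v)) = σ • (σ • v + σ • (σ • v))
    rw [smul_add, hσ3])
  have hFσσ : ∀ v : V, F (σ • (σ • v)) = F v + F (σ • v) := fun v ↦ Subtype.ext (by
    rw [AddSubgroup.coe_add, hF, hF, hF]
    simp only [hσ3]
    rw [add_assoc (σ • v) (σ • (σ • v)), ← add_assoc (σ • (σ • v)) (σ • (σ • v)) v, hV2, zero_add, add_comm])
  -- a group `A = {0, m₀}` of order `2` inside `M` and the coordinate projection `p : M →+ A`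
  obtain ⟨m₀, hm₀⟩ := klein_exists_ne_zero h4
  have hσm0 : σ • m₀ ≠ 0 := fun h ↦ hm₀ ((smul_eq_zero_iff_eq σ).mp h)
  have hσm : σ • m₀ ≠ m₀ := fun h ↦ hm₀ (hσ m₀ h)
  let A : AddSubgroup M :=
    { carrier := {x | x = 0 ∨ x = m₀}
      zero_mem' := Or.inl rfl
      add_mem' := by
        intro x y hx hy
        rcases hx with hx | hx <;> rcases hy with hy | hy <;>
          simp only [Set.mem_setOf_eq, hx, hy, add_zero, zero_add, h2, true_or, or_true]
      neg_mem' := by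
        intro x hx
        rcases hx with hx | hx <;>
          simp only [Set.mem_setOf_eq, hx, klein_neg_eq h2, true_or, or_true] }
  have hAmem : ∀ x : M, x ∈ A ↔ x = 0 ∨ x = m₀ := fun _ ↦ Iff.rfl
  have hA2 : ∀ a : A, a + a = 0 := fun a ↦ Subtype.ext (h2 a)
  have hAcases : ∀ a : A, (a : M) = 0 ∨ (a : M) = m₀ := fun a ↦ (hAmem a).mp a.2
  let g₀ : A := ⟨m₀, Or.inr rfl⟩
  have hg₀ : g₀ ≠ 0 := fun h ↦ hm₀ (congrArg Subtype.val h)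
  have hAcard : Nat.card A = 2 := by
    have e : Nat.card A = Nat.card ↥({0, m₀} : Set M) :=
      Nat.card_congr (Equiv.subtypeEquivRight fun x ↦ by
        rw [Set.mem_insert_iff, Set.mem_singleton_iff]; exact hAmem x)
    rw [e, Nat.card_coe_set_eq, Set.ncard_pair (Ne.symm hm₀)]
  have hA4 : Nat.card (A × A) = 4 := by rw [Nat.card_prod, hAcard]
  have hAA2 : ∀ x : A × A, x + x = 0 := fun x ↦ Prod.ext (hA2 x.1) (hA2 x.2)
  have hne1 : ((g₀, 0) : A × A) ≠ 0 := fun h ↦ hg₀ (congrArg Prod.fst h)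
  have hne2 : ((g₀, g₀) : A × A) ≠ 0 := fun h ↦ hg₀ (congrArg Prod.fst h)
  have hne3 : ((g₀, 0) : A × A) ≠ (g₀, g₀) := fun h ↦ hg₀ (congrArg Prod.snd h).symm
  obtain ⟨θ, hθa, hθb⟩ := klein_exists_addEquiv h4 h2 hA4 hAA2 hm₀ hσm0 (Ne.symm hσm) hne1 hne2 hne3
  let p : M →+ A := (AddMonoidHom.fst A A).comp θ.toAddMonoidHom
  have hpapply : ∀ x : M, p x = (θ x).1 := fun _ ↦ rfl
  have hp0 : p 0 = 0 := map_zero p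
  have hpa : p m₀ = g₀ := by rw [hpapply, hθa]
  have hpb : p (σ • m₀) = g₀ := by rw [hpapply, hθb]
  have hpc : p (m₀ + σ • m₀) = 0 := by rw [map_add, hpa, hpb]; exact hA2 g₀
  have hσσm₀ : σ • (σ • m₀) = m₀ + σ • m₀ := hσσM m₀
  -- `p (σ a) = a` and `p (σ² a) = 0` for `a ∈ A`
  have hpσ : ∀ a : A, p (σ • (a : M)) = a := by
    intro a
    rcases hAcases a with h | h
    · rw [h, smul_zero, hp0]; exact (Subtype.ext h).symm
    · rw [h, hpb]; exact (Subtype.ext h).symm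
  have hpσσ : ∀ a : A, p (σ • (σ • (a : M))) = 0 := by
    intro a
    rcases hAcases a with h | h
    · rw [h, smul_zero, smul_zero, hp0]
    · rw [h, hσσm₀, hpc]
  -- the reconstruction identity `x = σ • p x + σ² • p (σ x)` on `M`
  have hrec : ∀ x : M, σ • ((p x : A) : M) + σ • (σ • ((p (σ • x) : A) : M)) = x := by
    have hg₀val : ((g₀ : A) : M) = m₀ := rfl
    intro x
    rcases klein_cases h4 h2 hm₀ hσm0 (Ne.symm hσm) x with h | h | h | h <;> rw [h]
    · simp only [smul_zero, hp0, AddSubgroup.coe_zero, add_zero]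
    · rw [hpa, hpb, hg₀val]; exact hplusM m₀
    · rw [hpb, hg₀val, hσσm₀, hpc, AddSubgroup.coe_zero, smul_zero, smul_zero, add_zero]
    · have e : σ • (m₀ + σ • m₀) = m₀ := by rw [← hσσm₀]; exact hσ3M m₀
      rw [hpc, AddSubgroup.coe_zero, smul_zero, zero_add, e, hpa, hg₀val]
      exact hσσm₀
  -- the bijection `Hom_σ(V, M) ≃ (W →+ A)`
  let Ψ : {f : V →+ M // ∀ v : V, f (σ • v) = σ • f v} → (W →+ A) :=
    fun f ↦ p.comp (f.1.comp W.subtype)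
  let Φ : (W →+ A) → {f : V →+ M // ∀ v : V, f (σ • v) = σ • f v} := fun φ ↦
    ⟨(DistribSMul.toAddMonoidHom M σ).comp (A.subtype.comp (φ.comp F)) +
        (DistribSMul.toAddMonoidHom M (σ * σ)).comp (A.subtype.comp (φ.comp (F.comp
          (DistribSMul.toAddMonoidHom V σ)))), by
      intro v
      change σ • ((φ (F (σ • v)) : A) : M) + (σ * σ) • ((φ (F (σ • (σ • v))) : A) : M) =
        σ • (σ • ((φ (F v) : A) : M) + (σ * σ) • ((φ (F (σ • v)) : A) : M))
      rw [hFσσ, map_add, AddSubgroup.coe_add, mul_smul, mul_smul, smul_add, smul_add, smul_add, hσ3M,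
        add_left_comm, hplusM]⟩
  have hΦ : ∀ (φ : W →+ A) (v : V), (Φ φ).1 v =
      σ • ((φ (F v) : A) : M) + σ • (σ • ((φ (F (σ • v)) : A) : M)) := fun φ v ↦ by
    change σ • ((φ (F v) : A) : M) + (σ * σ) • ((φ (F (σ • v)) : A) : M) = _
    rw [mul_smul]
  have hΨ : ∀ (f : {f : V →+ M // ∀ v : V, f (σ • v) = σ • f v}) (w : W), Ψ f w = p (f.1 w) := fun _ _ ↦ rfl
  have hleft : ∀ f, Φ (Ψ f) = f := by
    intro f
    apply Subtype.ext
    ext v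
    rw [hΦ, hΨ, hΨ, hFσ]
    change σ • ((p (f.1 (F v : V)) : A) : M) + σ • (σ • ((p (f.1 (σ • (F v : V))) : A) : M)) = f.1 v
    rw [f.2, hrec, hF]
    exact (map_eq_map_f h4 h2 hσ f.1 f.2 v).symm
  have hright : ∀ φ, Ψ (Φ φ) = φ := by
    intro φ
    ext w
    have e : F (σ • (w : V)) = ⟨σ • (w : V), hσmem _ w.2⟩ := hFW ⟨σ • (w : V), hσmem _ w.2⟩
    rw [hΨ, hΦ, hFW, e, map_add, hpσ, hpσσ, add_zero]
  have eΨ : {f : V →+ M // ∀ v : V, f (σ • v) = σ • f v} ≃ (W →+ A) := ⟨Ψ, Φ, hleft, hright⟩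
  -- count
  haveI : Finite W := inferInstance
  rw [Nat.card_congr eΨ, natCard_addMonoidHom_of_two_torsion (fun w : W ↦ Subtype.ext (hV2 w)) hA2 hAcard]
  exact Nat.card_congr (Equiv.subtypeEquivRight fun w ↦ hW w)

end Count

/-! ## §4 `Q̄ = C₃`: `Q`-equivariant = `σ`-equivariant, so `#Hom_Q(V, M) = #((1 − e₁)V)` -/

section C3

variable {Q : Type*} [Group Q] {M : Type*} [AddCommGroup M] [DistribMulAction Q M]
  {V : Type*} [AddCommGroup V] [DistribMulAction Q V]

/-- When every element of `Q` acts on `M` trivially or without non-zero fixed point (`Q̄ ≤ A₃`), an additive map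
`V → M` commuting with the fixed-point-free `σ` commutes with all of `Q`: every `g` acts on `M` AND on `V` as
`σ^k n` with `n` acting trivially (`fpf_smul_dichotomy`). [folklore] -/
theorem equivariant_of_sigmaEquivariant_of_no_transposition (h4 : Nat.card M = 4) (h2 : ∀ m : M, m + m = 0)
    {σ : Q} (hσ : ∀ m : M, σ • m = m → m = 0)
    (hnoT : ∀ g : Q, (∀ m : M, g • m = m) ∨ (∀ m : M, g • m = m → m = 0))
    (hVN : ∀ g : Q, (∀ m : M, g • m = m) → ∀ v : V, g • v = v) (f : V →+ M)
    (hf : ∀ v : V, f (σ • v) = σ • f v) (g : Q) (v : V) : f (g • v) = g • f v := by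
  rcases hnoT g with hg | hg
  · rw [hVN g hg v, hg]
  · rcases fpf_smul_dichotomy h4 h2 hσ hg with e | e
    · -- `g` acts as `σ`: `σ⁻¹ g` is in the kernel
      have htriv : ∀ m : M, (σ⁻¹ * g) • m = m := fun m ↦ by rw [mul_smul, e, inv_smul_smul]
      have hv : g • v = σ • ((σ⁻¹ * g) • v) := by rw [mul_smul, smul_inv_smul]
      rw [hv, hVN _ htriv, hf, e]
    · have htriv : ∀ m : M, ((σ * σ)⁻¹ * g) • m = m := fun m ↦ by
        rw [mul_smul, e m, ← mul_smul σ σ m, inv_smul_smul]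
      have hv : g • v = σ • (σ • (((σ * σ)⁻¹ * g) • v)) := by
        rw [← mul_smul σ σ, mul_smul (σ * σ)⁻¹ g v, smul_inv_smul]
      rw [hv, hVN _ htriv, hf, hf, e]

/-- **Counting lemma for `Q̄ = C₃`** (PERFECT-DESCENT.md §3 (iii), «for `G_∞ = C₃` read `𝔽₄` for `N`»): with
`Q`, `M`, `σ`, `V` as in `natCard_sigmaEquivariant_eq` and NO element of `Q` acting on `M` as a transposition,
`#Hom_Q(V, M) = #{w ∈ V | w + σ w + σ² w = 0} = #((1 − e₁)V)`, i.e. `dim_{𝔽₂} Hom_Q(V, M) = dim_{𝔽₂}((1 − e₁)V)`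
(`= 2·[V : 𝔽₄]`). In particular `Hom_Q(V, M) = 0 ⟺ e₁ = 1` on `V`, and `Hom_Q(V, M)` grows with `(1 − e₁)V`.
[cite: SerreGaloisCohomology1997, I §5.1] -/
theorem natCard_equivariant_eq_of_no_transposition [Finite V] (h4 : Nat.card M = 4)
    (h2 : ∀ m : M, m + m = 0) {σ : Q} (hσ : ∀ m : M, σ • m = m → m = 0)
    (hnoT : ∀ g : Q, (∀ m : M, g • m = m) ∨ (∀ m : M, g • m = m → m = 0))
    (hVN : ∀ g : Q, (∀ m : M, g • m = m) → ∀ v : V, g • v = v) (hV2 : ∀ v : V, v + v = 0) :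
    Nat.card {f : V →+ M // ∀ (g : Q) (v : V), f (g • v) = g • f v} =
      Nat.card {w : V // w + σ • w + σ • (σ • w) = 0} := by
  rw [← natCard_sigmaEquivariant_eq h4 h2 hσ hVN hV2]
  exact Nat.card_congr (Equiv.subtypeEquivRight fun f ↦
    ⟨fun h v ↦ h σ v, fun h g v ↦ equivariant_of_sigmaEquivariant_of_no_transposition h4 h2 hσ hnoT hVN f h g v⟩)

end C3

end Summit.BirchSwinnertonDyer.BirchSwinnertonDyer.Theorems.AlignedTransportAtTwoFineRoad.PerfectDescent
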